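import Mathlib
import HarnessLib
import Summits.Parity.GeneralizedHardyLittlewood.Theses.LeeYangFibres
import Summits.Parity.GeneralizedHardyLittlewood.Theorems.LeeYangFibresModelHyperbolicity
import Summits.Parity.GeneralizedHardyLittlewood.Theorems.LeeYangFibresFibreHyperbolicityDefs

/-!
# Crux `FibreHyperbolicity` (stmt-Parity-14108), line "model transfer": the composition at fixed `t`

Registered stub `stub_assemble` of the skeleton `Cruxes/FibreHyperbolicity/Lines/SketchIdeator1.lean` (line
lead `prover-line-stmt-Parity-14108-0`), PROVED:

  `∀ t ≥ 1, PerturbLemma → CoeffBound → FibreExpansion → CellModelLaw t → FHAt t`.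

Given `t, L, u₀, η`: take `u := max u₀ 2`; the model polynomial `modelPoly u = Σ_{m<u} I_{m+1}(u) X^m` is nonzero
(constant coefficient `I_1 = 1`), has degree exactly `u − 2` (`I_{u-1}(u) > 0`) and `u − 2` distinct real roots
(`WindowChainTransport.stub_simpleZeros`, with `stub_calculus`, `stub_windowChain` — all landed); the
perturbation lemma gives a radius `ε_P`; the cell model law is invoked at accuracy
`ε_L := ε_P / (2^{t−1}(B+1))`, `B := Σ_{n<u} I_{n+1}(u)`; for an admissible `(N, Ψ, K, i, w)` the coefficient
bound turns the law into `|p_m/Λ' − I_m(u)| ≤ ε_P` for the fibre coefficients `p_m` (`Λ' > 0` because every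
`w_k > 0`), the fibre expansion writes the fibre as `Λ' ζ q(ζ)` with `q := Σ_{m<u} (p_{m+1}/Λ') X^m` of degree
`≤ u − 1 = deg + 1`, and the perturbation lemma makes every zero of `q` real.
-/

noncomputable section

namespace Summit.Parity.GeneralizedHardyLittlewood.Cruxes.FibreHyperbolicity.ModelTransfer

open scoped BigOperators Classical
open Finset Polynomial
open Literature.NumberTheory.Sieve
open Summit.Parity.GeneralizedHardyLittlewood.Cruxes.ModelHyperbolicity.WindowChainTransport (cellDensity)

/-! ## The composition at fixed `t` (registered stub `stub_assemble`, lead) -/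

section Assemble

open Summit.Parity.GeneralizedHardyLittlewood.Cruxes.ModelHyperbolicity.WindowChainTransport
  (modelPoly modelPoly_coeff cellDensity_zero ModelSimple stub_calculus stub_windowChain stub_simpleZeros calc_nonneg
    calc_pos)

/-- `I_u(u) = 0`: the top model density vanishes (`cellDensity (u-1) u = 0` for `u ≥ 2`). -/
theorem cellDensity_pred_self {u : ℕ} (hu : 2 ≤ u) : cellDensity (u - 1) u = 0 := by
  obtain ⟨v, rfl⟩ : ∃ v, u = v + 2 := ⟨u - 2, by omega⟩
  rw [show v + 2 - 1 = v + 1 from rfl]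
  exact stub_calculus.2.1 v _ (by push_cast; linarith)

/-- The model polynomial at `u ≥ 2` is nonzero, has degree exactly `u - 2` and `u - 2` distinct real roots. -/
theorem modelPoly_facts {u : ℕ} (hu : 2 ≤ u) :
    modelPoly u ≠ 0 ∧ (modelPoly u).natDegree = u - 2 ∧
      (modelPoly u).natDegree ≤ (modelPoly u).roots.toFinset.card := by
  have hS : ModelSimple u :=
    stub_simpleZeros stub_calculus (stub_windowChain stub_calculus).1 (stub_windowChain stub_calculus).2 u hu
  have h0 : (modelPoly u).coeff 0 = 1 := by
    rw [modelPoly_coeff, if_pos (by omega)]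
    exact cellDensity_zero _
  have hne : modelPoly u ≠ 0 := fun h => by simp [h] at h0
  have hdeg : (modelPoly u).natDegree = u - 2 := by
    refine le_antisymm hS.1 (le_natDegree_of_ne_zero ?_)
    rw [modelPoly_coeff, if_pos (by omega)]
    exact (calc_pos (u - 2) u (by rw [Nat.cast_sub hu]; push_cast; linarith)).ne'
  exact ⟨hne, hdeg, hdeg ▸ hS.2⟩

/-- **`stub_assemble` (registered; lead).** At fixed `t ≥ 1`: the cell model law, the simple real zeros of
the model polynomial (`WindowChainTransport.stub_simpleZeros`), the perturbation lemma and the fibre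
bookkeeping give `FHAt t`. Constants: `u := max u₀ 2`; `ε_P` from the perturbation lemma at
`Q = modelPoly u`; the law is invoked with `ε_L := ε_P / (2^{t-1} (B + 1))`, `B := Σ_{n<u} I_{n+1}(u)`. -/
theorem stub_assemble : ∀ t : ℕ, 1 ≤ t → PerturbLemma → CoeffBound → FibreExpansion →
    CellModelLaw t → FHAt t := by
  intro t _ht hP hC hE hLaw L u₀ η hη
  -- the degree cut-off
  set u : ℕ := max u₀ 2 with hu_def
  have hu2 : 2 ≤ u := le_max_right _ _
  have hu₀ : u₀ ≤ u := le_max_left _ _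
  -- the model polynomial and the perturbation radius
  obtain ⟨hQ0, hQdeg, hQroots⟩ := modelPoly_facts hu2
  obtain ⟨εP, hεP, hPert⟩ := hP (modelPoly u) hQ0 hQroots
  -- the densities as a sequence `I n = I_n(u) = cellDensity (n-1) u`
  set I : ℕ → ℝ := fun n => cellDensity (n - 1) u with hI_def
  have hI0 : ∀ n, 0 ≤ I n := fun n => calc_nonneg _ _
  have hI1 : I 1 = 1 := cellDensity_zero _
  have hIu : I u = 0 := cellDensity_pred_self hu2
  set B : ℝ := ∑ n ∈ Finset.range u, cellDensity n u with hB_def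
  have hB0 : 0 ≤ B := Finset.sum_nonneg fun n _ => calc_nonneg _ _
  have hIB : ∀ n, n < u → cellDensity n u ≤ B := fun n hn =>
    Finset.single_le_sum (f := fun n => cellDensity n u) (fun k _ => calc_nonneg k _) (Finset.mem_range.mpr hn)
  have h2t : (0 : ℝ) < 2 ^ (t - 1) := by positivity
  set εL : ℝ := εP / (2 ^ (t - 1) * (B + 1)) with hεL_def
  have hεL : 0 < εL := by positivity
  have hεL_le : ∀ n, n < u → 2 ^ (t - 1) * εL * (cellDensity n u + 1) ≤ εP := by
    intro n hn
    have h1 : 2 ^ (t - 1) * εL * (cellDensity n u + 1) ≤ 2 ^ (t - 1) * εL * (B + 1) :=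
      mul_le_mul_of_nonneg_left (by linarith [hIB n hn]) (by positivity)
    have h2 : 2 ^ (t - 1) * εL * (B + 1) = εP := by
      rw [hεL_def]; field_simp
    linarith
  -- the law at this accuracy
  obtain ⟨N₀, hN₀⟩ := hLaw L u hu2 η hη εL hεL
  refine ⟨u, hu₀, hu2, N₀, fun N hN Ψ hΨ hsize K hK hKN hmass i w hw ζ hζ => ?_⟩
  obtain ⟨Λ, hΛ, hcells⟩ := hN₀ N hN Ψ hΨ hsize K hK hKN hmass
  -- fibre coefficients and their bound
  set box := Fintype.piFinset (fun _ : Fin t => Finset.Icc 1 u) with hbox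
  set p : ℕ → ℝ := fun m => ∑ j ∈ box.filter (fun j => j i = m),
    (jointCell t N u Ψ K j : ℝ) * ∏ k ∈ Finset.univ.erase i, w k ^ (j k) with hp_def
  set Λ' : ℝ := Λ * ∏ k ∈ Finset.univ.erase i, ∑ n ∈ Finset.Icc 1 u, I n * w k ^ n with hΛ'_def
  have hΛ' : 0 < Λ' := by
    refine mul_pos hΛ (Finset.prod_pos fun k _ => ?_)
    have hmem : 1 ∈ Finset.Icc 1 u := Finset.mem_Icc.mpr ⟨le_rfl, by omega⟩
    refine lt_of_lt_of_le ?_ (Finset.single_le_sum (f := fun n => I n * w k ^ n)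
      (fun n _ => mul_nonneg (hI0 n) (pow_nonneg (hw k).1.le n)) hmem)
    rw [hI1, one_mul, pow_one]; exact (hw k).1
  have hcoeff : ∀ m ∈ Finset.Icc 1 u, |p m - Λ' * I m| ≤ 2 ^ (t - 1) * εL * Λ' * (I m + if m = u then 1 else 0) :=
    hC t u hu2 i (fun j => (jointCell t N u Ψ K j : ℝ)) I Λ εL w hI0 hI1 hIu hΛ.le hεL.le hw hcells
  -- the fibre as `Λ' ζ q(ζ)`
  have hfib : fibre t N u Ψ K i w ζ = ∑ m ∈ Finset.Icc 1 u, ((p m : ℝ) : ℂ) * ζ ^ m :=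
    hE t u i (jointCell t N u Ψ K) w ζ
  set q : ℝ[X] := ∑ m ∈ Finset.range u, C (p (m + 1) / Λ') * X ^ m with hq_def
  have hq_coeff : ∀ n, q.coeff n = if n < u then p (n + 1) / Λ' else 0 := by
    intro n
    rw [hq_def, finsetSum_coeff]
    simp only [coeff_C_mul_X_pow]
    rw [Finset.sum_ite_eq]
    simp [Finset.mem_range]
  have hq_eval : (q.map (algebraMap ℝ ℂ)).eval ζ = ∑ m ∈ Finset.range u, ((p (m + 1) / Λ' : ℝ) : ℂ) * ζ ^ m := by
    rw [hq_def, Polynomial.map_sum, eval_finsetSum]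
    simp only [Polynomial.map_mul, Polynomial.map_C, Polynomial.map_pow, Polynomial.map_X, eval_mul, eval_C,
      eval_pow, eval_X, Complex.coe_algebraMap]
  have hfactor : fibre t N u Ψ K i w ζ = (Λ' : ℂ) * ζ * (q.map (algebraMap ℝ ℂ)).eval ζ := by
    rw [hfib, hq_eval, Finset.mul_sum, ← Finset.Ico_add_one_right_eq_Icc, Finset.sum_Ico_eq_sum_range]
    refine Finset.sum_congr rfl fun m _ => ?_
    have hΛ'c : (Λ' : ℂ) ≠ 0 := Complex.ofReal_ne_zero.mpr hΛ'.ne'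
    rw [add_comm 1 m, Complex.ofReal_div]
    field_simp
    ring
  -- conclude
  rw [hfactor] at hζ
  rcases mul_eq_zero.mp hζ with h1 | h2
  · rcases mul_eq_zero.mp h1 with h3 | h4
    · exact absurd (Complex.ofReal_eq_zero.mp h3) hΛ'.ne'
    · simp [h4]
  · refine hPert q ?_ ?_ ζ h2
    · -- degree ≤ (u - 2) + 1
      rw [hQdeg, natDegree_le_iff_coeff_eq_zero]
      intro n hn
      rw [hq_coeff, if_neg (by omega)]
    · intro n
      rw [hq_coeff, modelPoly_coeff]
      by_cases hn : n < u
      · rw [if_pos hn, if_pos hn]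
        have hmem : n + 1 ∈ Finset.Icc 1 u := Finset.mem_Icc.mpr ⟨by omega, by omega⟩
        have hb := hcoeff (n + 1) hmem
        have hIn : I (n + 1) = cellDensity n u := by simp [hI_def]
        rw [hIn] at hb
        have hdiv : p (n + 1) / Λ' - cellDensity n u = (p (n + 1) - Λ' * cellDensity n u) / Λ' := by
          field_simp
        rw [hdiv, abs_div, abs_of_pos hΛ', div_le_iff₀ hΛ']
        calc |p (n + 1) - Λ' * cellDensity n u|
            ≤ 2 ^ (t - 1) * εL * Λ' * (cellDensity n u + if n + 1 = u then 1 else 0) := hb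
          _ ≤ 2 ^ (t - 1) * εL * Λ' * (cellDensity n u + 1) := by
              refine mul_le_mul_of_nonneg_left ?_ (by positivity)
              split_ifs <;> linarith [calc_nonneg n (u : ℝ)]
          _ = (2 ^ (t - 1) * εL * (cellDensity n u + 1)) * Λ' := by ring
          _ ≤ εP * Λ' := mul_le_mul_of_nonneg_right (hεL_le n hn) hΛ'.le
      · rw [if_neg hn, if_neg hn, sub_zero, abs_zero]
        exact hεP.le

end Assemble

end Summit.Parity.GeneralizedHardyLittlewood.Cruxes.FibreHyperbolicity.ModelTransfer

end
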